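import Summits.MatrixMultiplication.OmegaCensus.STPPKernelListerOrderN46N48N51R
import Summits.MatrixMultiplication.OmegaCensus.STPPCrossReadingCosetClashTools

/-!
# ω-census (abelian STPP census): `{(2,3,4),(3,2,4)}` has no STPP realisation in any abelian group of order `46` — one Kneser step in the full-coset quotient (kernel)

HONEST FRAMING (pub-omega census; verbatim): lottery ticket; floor = certified bounds/negative ranges.
Census EXCLUSION (seat pub-omega-stpp-2 gen 31, 2026-08-29), family (b2).  Same mechanism as `STPPCosetQuotientKillN44.lean`: order `46 = 2·23` (`ℤ₄₆` only),
pattern `{(2,3,4),(3,2,4)}` (one of the three order-46/47-type survivors; at the prime `47` it dies by the tight tiling law).  Readings `(B,A,C)` at block `0`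
and `(A,B,C)` at block `1` pin the outer Kneser stabilizer to order `2`: `A₀ = a + K`, `B₁ = b + K` with `K` THE subgroup of order `2`.  The TPP words of
blocks `0` and `1`, with their second term taken from `K = A₀ − A₀ = B₁ − B₁`, make `(C₀ − B₀) + K` and `(C₁ − A₁) + K` sets of `24 = 2·12` elements each; one
Kneser step (all divisors of `46`: `kLB(24,24,·) ≥ 46`) gives `−((C₁ − A₁) + K) + ((C₀ − B₀) + K) = H ∋ a − b₀`; unfolding, the Def-5.1 word
`a₁ − a₀ + b₀ − b₀′ + c₀ − c₁` (tree reading `(−A,−C,−B)` at indices `(1,0,0)`) vanishes — contradiction.  (In `H/K ≅ ℤ₂₃`: Cauchy–Davenport,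
`12 + 12 − 1 = 23`.)  Consequence: order `46` is conditional on `{234_234, 223_332_332}` only (`volume_le_of_card_eq_46_of_dead_q`).  Nothing here is
progress on `ω`.

References: M. Kneser, Math. Z. 58 (1953); H. Cohn, R. Kleinberg, B. Szegedy, C. Umans, FOCS 2005 (arXiv:math/0511460), Def. 5.1.
-/

open Finset
open scoped Pointwise

namespace Summit.MatrixMultiplication.OmegaCensus.CubeNB

open Literature.Computability.AlgebraicComplexity
open Literature.Combinatorics.Additive
open Summit.MatrixMultiplication.OmegaCensus.STPPKneser

variable {H : Type*} [AddCommGroup H] [DecidableEq H] [Fintype H]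

/-- **`{(2,3,4),(3,2,4)}` has no STPP realisation in any abelian group of order `46`.** [cite: Kneser1953] [cite: CohnKleinbergSzegedyUmans2005, Def. 5.1] -/
theorem no_isSTPP_card46_234_324 (hH : Fintype.card H = 46) (A B C : Fin 2 → Finset H) (hS : IsSTPP A B C)
    (hA : ∀ i, #(A i) = ![2, 3] i) (hB : ∀ i, #(B i) = ![3, 2] i) (hC : ∀ i, #(C i) = ![4, 4] i) : False := by
  have hAne : ∀ i, (A i).Nonempty := fun i => card_pos.1 (by rw [hA]; fin_cases i <;> simp)
  have hBne : ∀ i, (B i).Nonempty := fun i => card_pos.1 (by rw [hB]; fin_cases i <;> simp)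
  have hCne : ∀ i, (C i).Nonempty := fun i => card_pos.1 (by rw [hC]; fin_cases i <;> simp)
  have hR : IsSTPP (fun j => -(A j)) (fun j => -(C j)) (fun j => -(B j)) := stpp_rotate (stpp_rotate (isSTPP_neg_reverse hS))
  obtain ⟨K1, hK1, hK1q, t1, -, hs1⟩ := exists_carrier_middle_subset_coset' (stpp_rotate (isSTPP_neg_reverse hS)) (nonempty_neg_family hBne)
    (nonempty_neg_family hAne) (nonempty_neg_family hCne) 0 ⟨1, by decide⟩ (n := 46) (q := 2) (z := 8) (b := 2) (vol := 24) (a := 3) (L := 12) hH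
    (by simp only [Finset.card_neg, hB]; decide) (by simp only [Finset.card_neg, hA]; decide) (by simp only [Finset.card_neg, hA, hB, hC]; decide)
    (by simp only [Finset.card_neg, hB, hC]; decide) (by simp only [Finset.card_neg, hA, hC]; decide) (by decide)
  have hsub1 : A 0 ⊆ (-t1) +ᵥ K1 := subset_coset_of_neg_subset hK1 hs1
  obtain ⟨K2, hK2, hK2q, t2, -, hs2⟩ := exists_carrier_middle_subset_coset' hS hAne hBne hCne 1 ⟨0, by decide⟩
    (n := 46) (q := 2) (z := 8) (b := 2) (vol := 24) (a := 3) (L := 12) hH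
    (by simp only [hA]; decide) (by simp only [hB]; decide) (by simp only [hA, hB, hC]; decide)
    (by simp only [hA, hC]; decide) (by simp only [hB, hC]; decide) (by decide)
  have hK : K1 = K2 := eq_of_card_eq_coprime hK1 hK2 (m := 23) hK1q hK2q (by rw [hH]) (by decide)
  subst hK
  set K := K1 with hKdef
  have hA0 : A 0 = (-t1) +ᵥ K := Finset.eq_of_subset_of_card_le hsub1 (by rw [Finset.card_vadd_finset, hK1q, hA]; decide)
  have hB1 : B 1 = t2 +ᵥ K := Finset.eq_of_subset_of_card_le hs2 (by rw [Finset.card_vadd_finset, hK1q, hB]; decide)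
  have memA0 : ∀ k ∈ K, -t1 + k ∈ A 0 := fun k hk => by rw [hA0]; exact Finset.mem_vadd_finset.2 ⟨k, hk, rfl⟩
  have memB1 : ∀ k ∈ K, t2 + k ∈ B 1 := fun k hk => by rw [hB1]; exact Finset.mem_vadd_finset.2 ⟨k, hk, rfl⟩
  have hKne : K.Nonempty := hK1.nonempty
  -- |(C₀ − B₀) + K| = 24 (TPP of block 0, second term from K = A₀ − A₀)
  have hD0 : #(D B C 0 + K) = 24 := by
    rw [← Finset.image_add_product, Finset.card_image_of_injOn, Finset.card_product, card_D_BC hS hAne 0, hB, hC, hK1q]; · rfl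
    rintro ⟨d, k⟩ hdk ⟨d', k'⟩ hdk' (h : d + k = d' + k')
    simp only [Finset.coe_product, Set.mem_prod, Finset.mem_coe] at hdk hdk'
    obtain ⟨b, hb, c, hc, rfl⟩ := mem_D.1 hdk.1
    obtain ⟨b', hb', c', hc', rfl⟩ := mem_D.1 hdk'.1
    have hw : ((-t1 + k) - (-t1 + k')) + (b' - b) + (c - c') = 0 := by
      have : c - b + k - (c' - b' + k') = 0 := sub_eq_zero.2 h
      rw [← this]; abel
    obtain ⟨-, -, h1, h2, h3⟩ := hS 0 0 0 (-t1 + k') (memA0 k' hdk'.2) (-t1 + k) (memA0 k hdk.2) b hb b' hb' c' hc' c hc hw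
    have hk : k' = k := by simpa using h1
    rw [h2, h3, hk]
  -- |(C₁ − A₁) + K| = 24 (TPP of block 1, second term from K = B₁ − B₁)
  have hD1 : #(D A C 1 + K) = 24 := by
    rw [← Finset.image_add_product, Finset.card_image_of_injOn, Finset.card_product, card_D_AC hS hBne 1, hA, hC, hK1q]; · rfl
    rintro ⟨d, k⟩ hdk ⟨d', k'⟩ hdk' (h : d + k = d' + k')
    simp only [Finset.coe_product, Set.mem_prod, Finset.mem_coe] at hdk hdk'
    obtain ⟨a, ha, c, hc, rfl⟩ := mem_D.1 hdk.1
    obtain ⟨a', ha', c', hc', rfl⟩ := mem_D.1 hdk'.1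
    have hw : (a' - a) + ((t2 + k) - (t2 + k')) + (c - c') = 0 := by
      have : c - a + k - (c' - a' + k') = 0 := sub_eq_zero.2 h
      rw [← this]; abel
    obtain ⟨-, -, h1, h2, h3⟩ := hS 1 1 1 a ha a' ha' (t2 + k') (memB1 k' hdk'.2) (t2 + k) (memB1 k hdk.2) c' hc' c hc hw
    have hk : k' = k := by simpa using h2
    rw [h1, h3, hk]
  -- one Kneser step over the divisors of 46: U := −((C₁ − A₁) + K) + ((C₀ − B₀) + K) is everything
  have hne0 : (D B C 0 + K).Nonempty := (D_nonempty (hBne 0) (hCne 0)).add hKne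
  have hne1 : (-(D A C 1 + K)).Nonempty := ((D_nonempty (hAne 1) (hCne 1)).add hKne).neg
  have hUge : 46 ≤ #(-(D A C 1 + K) + (D B C 0 + K)) := by
    obtain ⟨d, hd, hdvd, hk⟩ := exists_dvd_kneserLB_le_card_add (-(D A C 1 + K)) (D B C 0 + K) hne1 hne0
    rw [Finset.card_neg, hD1, hD0, hH] at *
    have hmem : d ∈ Nat.divisors 46 := Nat.mem_divisors.2 ⟨hdvd, by norm_num⟩
    exact le_trans ((by decide : ∀ d ∈ Nat.divisors 46, 46 ≤ kneserLB 24 24 d) d hmem) hk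
  have hU : -(D A C 1 + K) + (D B C 0 + K) = univ := Finset.eq_univ_of_card _ (le_antisymm (Finset.card_le_univ _) (hH ▸ hUge))
  -- a − b₀ ∈ U unfolds to the Def-5.1 word a₁ − a₀ + b₀ − b₀′ + c₀ − c₁ (reading (−A,−C,−B), indices (1,0,0))
  obtain ⟨b0, hb0⟩ := hBne 0
  have hmem : -t1 - b0 ∈ -(D A C 1 + K) + (D B C 0 + K) := hU ▸ Finset.mem_univ _
  obtain ⟨x, hx, y, hy, hxy⟩ := Finset.mem_add.1 hmem
  rw [Finset.mem_neg] at hx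
  obtain ⟨x', hx', hxx⟩ := hx
  obtain ⟨d1, hd1, k1, hk1, rfl⟩ := Finset.mem_add.1 hx'
  obtain ⟨a1, ha1, c1, hc1, rfl⟩ := mem_D.1 hd1
  obtain ⟨d0, hd0, k0, hk0, rfl⟩ := Finset.mem_add.1 hy
  obtain ⟨b0', hb0', c0, hc0, rfl⟩ := mem_D.1 hd0
  have ha0 : -t1 + (k1 - k0) ∈ A 0 := memA0 _ (hK1.sub_mem hk1 hk0)
  have hword : (-a1 - -(-t1 + (k1 - k0))) + (-c0 - -c1) + (-b0 - -b0') = 0 := by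
    have e : x + (c0 - b0' + k0) = -t1 - b0 := hxy
    rw [← hxx] at e
    have : -a1 - -(-t1 + (k1 - k0)) + (-c0 - -c1) + (-b0 - -b0') = -(-(c1 - a1 + k1) + (c0 - b0' + k0)) + (-t1 - b0) := by abel
    rw [this, e]; abel
  obtain ⟨h10, -⟩ := hR 1 0 0 (-(-t1 + (k1 - k0))) (by simpa using ha0) (-a1) (by simpa using ha1) (-c1) (by simpa using hc1)
    (-c0) (by simpa using hc0) (-b0') (by simpa using hb0') (-b0) (by simpa using hb0) hword
  exact absurd h10 (by decide)

section Capstone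

open Summit.MatrixMultiplication.OmegaCensus.KLister

/-- `234_324` is not realisable in any abelian group of order `46`. [cite: CohnKleinbergSzegedyUmans2005, Def. 5.1] -/
theorem notRealizable_card46_234_324 (hH : Fintype.card H = 46) : ¬ Realizable H ([(2, 3, 4), (3, 2, 4)] : List Shape) := by
  intro h
  obtain ⟨A, B, C, hS, hc⟩ := h.out
  exact no_isSTPP_card46_234_324 hH A B C hS (fun i => by fin_cases i <;> exact (hc _).2.2.2.1)
    (fun i => by fin_cases i <;> exact (hc _).2.2.2.2.1) (fun i => by fin_cases i <;> exact (hc _).2.2.2.2.2)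

end Capstone

end Summit.MatrixMultiplication.OmegaCensus.CubeNB

namespace Summit.MatrixMultiplication.OmegaCensus.KLister

open Literature.Computability.AlgebraicComplexity
open Summit.MatrixMultiplication.OmegaCensus.CubeNB

/-- Residual dead list at order `46`: `234_234`, `223_332_332`. [folklore] -/
def deadN46q : List (List Shape) :=
  [[(2, 3, 4), (2, 3, 4)],
   [(2, 2, 3), (3, 3, 2), (3, 3, 2)]]

/-- **Order `46` conditional capstone, residual list of 2** (was 5; `…_of_dead_r` had 3). [cite: CohnKleinbergSzegedyUmans2005, Def. 5.1] -/
theorem volume_le_of_card_eq_46_of_dead_q {H : Type*} [AddCommGroup H] [Fintype H] [DecidableEq H] (hH : Fintype.card H = 46)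
    (hdead : ∀ D ∈ deadN46q, ¬ Realizable H D)
    {m : ℕ} (A B C : Fin m → Finset H) (hS : IsSTPP A B C) : ∑ i, #(A i) * #(B i) * #(C i) ≤ 46 := by
  refine volume_le_of_card_eq_46_of_dead_r hH ?_ A B C hS
  intro D hD
  simp only [deadN46r, List.mem_cons, List.not_mem_nil, or_false] at hD
  rcases hD with rfl | rfl | rfl
  · exact hdead _ (by simp [deadN46q])
  · exact notRealizable_card46_234_324 hH
  · exact hdead _ (by simp [deadN46q])

end Summit.MatrixMultiplication.OmegaCensus.KLister
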